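import Literature.AlgebraicGeometry.KTheory.HuHypercohomologyCriteria
import Literature.AlgebraicGeometry.Crystalline.HuComplexesDivision
import HarnessLib

/-!
# The lattice lemmas of line `hu` from torsion-freeness alone

Continuation of `KTheory/HuHypercohomologyCriteria`. There the two lattice lemmas (L1), (L2) on the
hypercohomology `huH` of X. Hu's complexes (the hypotheses `hL1`, `hL2` of the Summits-side
reduction of crux `FormalLiftingFromClassLifting`, route `HodgeConjecture/PadicSemiregularLift`)
were derived from torsion-freeness of the groups `staircaseH p k 𝒳 r M i = ℍⁱ(σ≤(r-1) p^{(r-•)M}Ω•)`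
plus, for (L2), a DIVISIBILITY hypothesis (iii). Using the division of the truncated inclusions by
`p^{N-M}` (`Crystalline/HuComplexesDivision`: `(× p^{N-M}) ≫ incl = p^{N-M} • incl̂` with
`(× p^{N-M})` an isomorphism on `σ≤(r-1)` when the `Ωʲ` have no `p`-torsion), this file discharges
(iii):

* `staircaseHLE_divisible` — under `[∀ j, Mono (p • 𝟙 Ωʲ)]` (smooth `𝒳/W(k)`:
  `IsSmoothProperModel.mono_p_smul_id_algebraicDeRhamComplex_X`), the image of
  `ℍⁱ(σ≤(r-1) p^{(r-•)N}Ω•) → ℍⁱ(σ≤(r-1) p^{(r-•)M}Ω•)` is divisible by `p^{N-M}`;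
* `huObstructionTarget_family_eq_zero_of_torsionFree` — **(L2) from torsion-freeness**: for
  `1 ≤ r < d`, if `ℍ^{2r}(σ≤(r-1) p^{(r-•)}Ω•)` and all `ℍ^{2r+1}(σ≤(r-1) p^{(r-•)(N+2)}Ω•)` have no
  `p`-torsion, then compatible families in `N ↦ ⊕_{r<d} ℍ^{2r}(p^{r,1}_{r,N+2}Ω•)` killed by a
  non-zero integer vanish (verbatim `hL2`);
* `huLattice_of_torsionFree` — (L1) ∧ (L2) from: no `p`-torsion in
  `ℍ^{2r}(σ≤(r-1) p^{(r-•)(N+2)}Ω•)` (`1 ≤ r < p`), in `ℍ^{2r}(σ≤(r-1) p^{(r-•)}Ω•)` and in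
  `ℍ^{2r+1}(σ≤(r-1) p^{(r-•)(N+2)}Ω•)` (`1 ≤ r < d`).

What produces these torsion-freeness inputs: the columns of `σ≤(r-1) p^{(r-•)M}Ω•` are
`p^{(r-j)M}Ωʲ ≅ Ωʲ`, `j ≤ r - 1` (`Algebra/Homology/StaircaseRetraction.powImageXIso`), with
`Hᵇ(𝒳, Ω⁰) = structureSheafCohomology`, `Hᵇ(𝒳, Ω¹) = hodgeCohomologyOne`
(`Crystalline/DeRhamComplexSheaf`), and the connecting maps of the stupid filtration are torsion by
`Crystalline.HodgeDeRhamDegeneratesModTorsion` transported along the retraction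
(`Algebra/Homology/StupidFiltrationDegeneration`). [folklore] Everything is proved; no named facts.
-/

noncomputable section

set_option synthInstance.maxHeartbeats 200000

namespace Literature.AlgebraicGeometry.KTheory.HuStaircase

open CategoryTheory CategoryTheory.Limits _root_.AlgebraicGeometry _root_.TopologicalSpace
  Literature.AlgebraicGeometry.Motives Literature.AlgebraicGeometry.Crystalline
  Literature.Algebra.Homology Literature.AlgebraicGeometry.KTheory

section Divisibility

variable (p : ℕ) [Fact p.Prime] (k : Type) [CommRing k] (𝒳 : SchemeOver (WittVector p k))

/-- **Divisibility of the images of the truncated inclusions**: if the terms `Ωʲ` of the algebraic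
de Rham complex of `𝒳` have no `p`-torsion, then for `M ≤ N` every element of the image of
`ℍⁱ(σ≤(r-1) p^{(r-•)N}Ω•) → ℍⁱ(σ≤(r-1) p^{(r-•)M}Ω•)` is divisible by `p^{N-M}` (the inclusion is
`p^{N-M}` times the composite of the inverse of the isomorphism `(× p^{N-M})` with an inclusion).
[folklore] -/
theorem staircaseHLE_divisible [∀ j, Mono (((p : ℕ) : ℤ) • 𝟙 ((algebraicDeRhamComplex 𝒳).X j))]
    (r : ℕ) {M N : ℕ} (h : M ≤ N) (i : ℤ) (x : staircaseH p k 𝒳 r N i) :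
    ∃ y : staircaseH p k 𝒳 r M i, staircaseHLE p k 𝒳 r h i x = ((p : ℤ) ^ (N - M)) • y := by
  haveI := isIso_deRhamStaircaseHatTruncMul 𝒳 (p : ℤ) r M N
  obtain ⟨x', rfl⟩ := (HyperExt.map_bijective_of_isIso
    (X := constantSheafInt (Opens.grothendieckTopology 𝒳.left))
    (deRhamStaircaseHatTruncMul 𝒳 (p : ℤ) r M N) i).2 x
  refine ⟨HyperExt.map (deRhamStaircaseHatTruncLE 𝒳 (p : ℤ) r h) i x', ?_⟩
  rw [← HyperExt.map_comp, deRhamStaircaseHatTruncMul_comp_TruncLE, HyperExt.map_zsmul_hom]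

/-- **(L2) from torsion-freeness.** For `1 ≤ r < d` suppose `ℍ^{2r}(σ≤(r-1) p^{(r-•)}Ω•)` has no
`p`-torsion and every `ℍ^{2r+1}(σ≤(r-1) p^{(r-•)(N+2)}Ω•)` has no `p`-torsion, and that the `Ωʲ`
have no `p`-torsion (smooth `𝒳/W(k)`). Then on the tower
`N ↦ ⊕_{r<d} ℍ^{2r}(p^{r,1}_{r,N+2}Ω•)` (`HuObstructionTarget p k 𝒳 d 1 (N+2)`) every family
compatible under `HuObstructionTarget.reduce d 1 (Nat.le_succ (N + 2))` and killed by a non-zero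
integer vanishes — the hypothesis `hL2` of `levelwiseClassLift_of_huLiftingCriterion` (Summits, line
`hu`), verbatim. [folklore] -/
theorem huObstructionTarget_family_eq_zero_of_torsionFree
    [∀ j, Mono (((p : ℕ) : ℤ) • 𝟙 ((algebraicDeRhamComplex 𝒳).X j))] (d : ℕ)
    (htfH : ∀ (r : ℕ), 1 ≤ r → r < d → ∀ x : staircaseH p k 𝒳 r 1 (2 * (r : ℤ)),
      (p : ℤ) • x = 0 → x = 0)
    (htf1 : ∀ (r : ℕ), 1 ≤ r → r < d → ∀ (N : ℕ) (x : staircaseH p k 𝒳 r (N + 2) (2 * (r : ℤ) + 1)),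
      (p : ℤ) • x = 0 → x = 0) :
    ∀ (L : ℤ), L ≠ 0 → ∀ o : (∀ N : ℕ, HuObstructionTarget p k 𝒳 d 1 (N + 2)),
      (∀ N, HuObstructionTarget.reduce d 1 (Nat.le_succ (N + 2)) (o (N + 1)) = o N) →
      (∀ N, L • o N = 0) → ∀ N, o N = 0 :=
  huObstructionTarget_family_eq_zero p k 𝒳 d htfH htf1 fun r _ _ N x ↦ by
    obtain ⟨y, hy⟩ := staircaseHLE_divisible p k 𝒳 r (show 1 ≤ N + 2 by omega) (2 * (r : ℤ)) x
    exact ⟨y, hy⟩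

/-- **Both lattice lemmas of line `hu` from torsion-freeness.** If the `Ωʲ` have no `p`-torsion and
(a) no `ℍ^{2r}(σ≤(r-1) p^{(r-•)(N+2)}Ω•)` (`1 ≤ r < p`, `N ≥ 0`) has `p`-torsion, (b) no
`ℍ^{2r}(σ≤(r-1) p^{(r-•)}Ω•)` (`1 ≤ r < d`) has `p`-torsion, (c) no `ℍ^{2r+1}(σ≤(r-1) p^{(r-•)(N+2)}Ω•)`
(`1 ≤ r < d`, `N ≥ 0`) has `p`-torsion, then (L1) the transitions `HuKernelSource.reduce 1 (N+2 ≤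
N+3)` are onto and (L2) compatible families of `HuObstructionTarget`s killed by a non-zero integer
vanish — the two remaining hypotheses of the conditional closure of crux
`FormalLiftingFromClassLifting` through X. Hu's named facts. [folklore] -/
theorem huLattice_of_torsionFree [∀ j, Mono (((p : ℕ) : ℤ) • 𝟙 ((algebraicDeRhamComplex 𝒳).X j))]
    (d : ℕ)
    (htfK : ∀ (r : ℕ), 1 ≤ r → r < p → ∀ (N : ℕ) (x : staircaseH p k 𝒳 r (N + 2) (2 * (r : ℤ))),
      (p : ℤ) • x = 0 → x = 0)
    (htfH : ∀ (r : ℕ), 1 ≤ r → r < d → ∀ x : staircaseH p k 𝒳 r 1 (2 * (r : ℤ)),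
      (p : ℤ) • x = 0 → x = 0)
    (htf1 : ∀ (r : ℕ), 1 ≤ r → r < d → ∀ (N : ℕ) (x : staircaseH p k 𝒳 r (N + 2) (2 * (r : ℤ) + 1)),
      (p : ℤ) • x = 0 → x = 0) :
    (∀ N : ℕ, Function.Surjective
        (HuKernelSource.reduce (p := p) (k := k) (𝒳 := 𝒳) 1 (Nat.le_succ (N + 2)))) ∧
      ∀ (L : ℤ), L ≠ 0 → ∀ o : (∀ N : ℕ, HuObstructionTarget p k 𝒳 d 1 (N + 2)),
        (∀ N, HuObstructionTarget.reduce d 1 (Nat.le_succ (N + 2)) (o (N + 1)) = o N) →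
        (∀ N, L • o N = 0) → ∀ N, o N = 0 :=
  ⟨huKernelSource_reduce_surjective_of_torsionFree p k 𝒳 htfK,
    huObstructionTarget_family_eq_zero_of_torsionFree p k 𝒳 d htfH htf1⟩

/-- **Both lattice lemmas, with the kernel side split at `r = d`.** As `huLattice_of_torsionFree`, but
(a) only for `1 ≤ r < d`, together with (a') the surjectivity of Hu's odd reductions
`ℍ^{2r-1}(p^{r,1}_{r,N+3}) → ℍ^{2r-1}(p^{r,1}_{r,N+2})` for `d ≤ r < p` as a hypothesis (high weights:
support on the special fibre, `Crystalline/HuComplexesHighWeight`) — the form in which, for `d ≤ 3`,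
only the columns `𝒪` and `Ω¹` (the crux's typed torsion-freeness hypotheses) enter. [folklore] -/
theorem huLattice_of_torsionFree_of_high
    [∀ j, Mono (((p : ℕ) : ℤ) • 𝟙 ((algebraicDeRhamComplex 𝒳).X j))] (d : ℕ)
    (htfK : ∀ (r : ℕ), 1 ≤ r → r < d → ∀ (N : ℕ) (x : staircaseH p k 𝒳 r (N + 2) (2 * (r : ℤ))),
      (p : ℤ) • x = 0 → x = 0)
    (hhigh : ∀ (r : ℕ), d ≤ r → r < p → ∀ N : ℕ,
      Function.Surjective (huHReduce p k 𝒳 r 1 (Nat.le_succ (N + 2)) (2 * (r : ℤ) - 1)))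
    (htfH : ∀ (r : ℕ), 1 ≤ r → r < d → ∀ x : staircaseH p k 𝒳 r 1 (2 * (r : ℤ)),
      (p : ℤ) • x = 0 → x = 0)
    (htf1 : ∀ (r : ℕ), 1 ≤ r → r < d → ∀ (N : ℕ) (x : staircaseH p k 𝒳 r (N + 2) (2 * (r : ℤ) + 1)),
      (p : ℤ) • x = 0 → x = 0) :
    (∀ N : ℕ, Function.Surjective
        (HuKernelSource.reduce (p := p) (k := k) (𝒳 := 𝒳) 1 (Nat.le_succ (N + 2)))) ∧
      ∀ (L : ℤ), L ≠ 0 → ∀ o : (∀ N : ℕ, HuObstructionTarget p k 𝒳 d 1 (N + 2)),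
        (∀ N, HuObstructionTarget.reduce d 1 (Nat.le_succ (N + 2)) (o (N + 1)) = o N) →
        (∀ N, L • o N = 0) → ∀ N, o N = 0 :=
  ⟨huKernelSource_reduce_surjective_of_torsionFree_of_high p k 𝒳 d htfK hhigh,
    huObstructionTarget_family_eq_zero_of_torsionFree p k 𝒳 d htfH htf1⟩

end Divisibility

end Literature.AlgebraicGeometry.KTheory.HuStaircase

end
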